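import Literature.Probability.LatticeModels.HitOriginBeforeExit
import HarnessLib

/-!
# Escape from the origin before returning: `G_A(0,0) · P⁰(ξ_A < τ₀⁺) = 1` and
# `P⁰(ξ_A < τ₀⁺) ≍ π/(2 log dist(0, ∂A))` (Lawler 1991, §1.6; Lawler–Limic 2010, Prop. 6.4.?)

Topic `Literature/Probability/LatticeModels`; discrete potential theory on `ℤ²`, companion of
`KilledGreenLogBounds.lean` (`G_A(x,0) = SRW.killedGreen (ChordalLERW.siteGraph A) x 0`, the
expected number of visits to `0` before leaving the finite set `A`). Two renewal identities of
the killed walk, proved from the first-step equation and the uniqueness of the discrete Dirichlet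
problem on `A ∖ {0}` (`green_representation`):

* `KozdronLawler.killedGreen_eq_hitProb_mul` — **`G_A(x,0) = P^x(τ_0 < ξ_A) · G_A(0,0)`** for
  `x ≠ 0`, with `P^x(τ_0 < ξ_A) = H_{A∖{0}}(x,0) = poissonKernel (A.erase 0) x 0`;
* `KozdronLawler.killedGreen_origin_mul_escape` — **`G_A(0,0) · (1 - ρ_A) = 1`**,
  `ρ_A = ¼ Σ_{w ∼ 0} H_{A∖{0}}(w,0) = P⁰(τ₀⁺ < ξ_A)` the probability of returning to the origin
  before leaving `A`;
* `KozdronLawler.escape_log_bounds` — hence, for exit points in an annulus `r ≤ |z| ≤ R` (`r ≥ 1`),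
  **`(1 - ρ_A)((2/π) log r + k₀ - C/r) ≤ 1 ≤ (1 - ρ_A)((2/π) log R + k₀ + C/r)`**, i.e.
  `P⁰(ξ_A < τ₀⁺) = 1/((2/π) log n + k₀ + O(1/n))` for the disc `C_n` (the first display of the proof
  of Lawler 1991, Thm. 2.5.2).

No named fact is introduced.

## References

* G. F. Lawler, *Intersections of Random Walks* (1991), §1.5–1.6, proof of Thm. 2.5.2 [Lawler1991].
* G. F. Lawler, V. Limic, *Random Walk: A Modern Introduction* (2010), §4.6, §6.4 [LawlerLimic2010].
-/

noncomputable section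

open Finset
open Literature.Probability.RandomPlanarGeometry (ChordalLERW.siteGraph)

namespace Literature.Probability.LatticeModels

namespace KozdronLawler

section PlanarSet

variable (A : Finset (Site 2))

/-- `x ↦ G_A(x,0)` is harmonic on `A ∖ {0}` (first-step equation off the pole). [folklore] -/
theorem latticeLaplacianZd_killedGreen_eq_zero (h0 : (0 : Site 2) ∈ A) {y : Site 2} (hy : y ∈ A)
    (hy0 : y ≠ 0) :
    latticeLaplacianZd (fun w => SRW.killedGreen (ChordalLERW.siteGraph (↑A : Set (Site 2))) w 0) y = 0 := by
  classical
  rw [latticeLaplacianZd_eq_sum_neighborFinset, Finset.sum_sub_distrib, Finset.sum_const,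
    card_neighborFinset_zdGraph_holds, nsmul_eq_mul]
  have hfs := killedGreen_siteGraph_first_step A hy 0
  rw [if_neg hy0, zero_add] at hfs
  have hsum : ∑ w ∈ (zdGraph 2).neighborFinset y,
      (if w ∈ A then SRW.killedGreen (ChordalLERW.siteGraph (↑A : Set (Site 2))) w 0 else 0) =
      ∑ w ∈ (zdGraph 2).neighborFinset y, SRW.killedGreen (ChordalLERW.siteGraph (↑A : Set (Site 2))) w 0 := by
    refine Finset.sum_congr rfl fun w _ => ?_
    split_ifs with hw
    · rfl
    · exact (killedGreen_siteGraph_of_not_mem A hw h0).symm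
  rw [hsum] at hfs
  rw [hfs]
  push_cast
  ring

/-- **`G_A(x,0) = P^x(τ_0 < ξ_A) G_A(0,0)`** (strong Markov property at the hitting time of the
origin; here: uniqueness of the Dirichlet problem on `A ∖ {0}` for the harmonic function
`x ↦ G_A(x,0)`, which vanishes on `∂A` and equals `G_A(0,0)` at `0`), with
`P^x(τ_0 < ξ_A) = poissonKernel (A.erase 0) x 0`. [cite: Lawler1991, §1.5] -/
theorem killedGreen_eq_hitProb_mul (h0 : (0 : Site 2) ∈ A) {x : Site 2} (hx0 : x ≠ 0) :
    SRW.killedGreen (ChordalLERW.siteGraph (↑A : Set (Site 2))) x 0 =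
      poissonKernel (A.erase 0) x 0 * SRW.killedGreen (ChordalLERW.siteGraph (↑A : Set (Site 2))) 0 0 := by
  classical
  set F : Site 2 → ℝ := fun w => SRW.killedGreen (ChordalLERW.siteGraph (↑A : Set (Site 2))) w 0 with hF
  by_cases hx : x ∈ A
  · have hx' : x ∈ A.erase 0 := Finset.mem_erase.2 ⟨hx0, hx⟩
    have hrep := green_representation (by norm_num : 0 < 2) (A.erase 0) F hx'
    have hsum0 : ∑ y ∈ A.erase 0, dirichletGreen (A.erase 0) x y * -latticeLaplacianZd F y = 0 := by
      refine Finset.sum_eq_zero fun y hy => ?_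
      obtain ⟨hy0, hyA⟩ := Finset.mem_erase.1 hy
      rw [hF, latticeLaplacianZd_killedGreen_eq_zero A h0 hyA hy0, neg_zero, mul_zero]
    rw [hsum0, zero_add] at hrep
    -- on `∂(A ∖ {0})` the function `F` vanishes except possibly at `0`
    have hbd : ∀ z ∈ outerBoundary (zdGraph 2) (A.erase 0), z ≠ 0 → F z = 0 := by
      intro z hz hz0
      have hzA : z ∉ A := fun hzA => (mem_outerBoundary_iff.1 hz).1 (Finset.mem_erase.2 ⟨hz0, hzA⟩)
      exact killedGreen_siteGraph_of_not_mem A hzA h0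
    have hsum : ∑ z ∈ outerBoundary (zdGraph 2) (A.erase 0), poissonKernel (A.erase 0) x z * F z =
        poissonKernel (A.erase 0) x 0 * F 0 := by
      by_cases h0S : (0 : Site 2) ∈ outerBoundary (zdGraph 2) (A.erase 0)
      · rw [← Finset.add_sum_erase _ _ h0S]
        rw [Finset.sum_eq_zero fun z hz => ?_, add_zero]
        obtain ⟨hz0, hzS⟩ := Finset.mem_erase.1 hz
        rw [hbd z hzS hz0, mul_zero]
      · rw [poissonKernel_of_not_mem_outerBoundary (A.erase 0) x h0S, zero_mul]
        refine Finset.sum_eq_zero fun z hz => ?_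
        have hz0 : z ≠ 0 := fun h => h0S (h ▸ hz)
        rw [hbd z hz hz0, mul_zero]
    rw [hsum] at hrep
    exact hrep
  · rw [killedGreen_siteGraph_of_not_mem A hx h0,
      poissonKernel_of_not_mem_left (A.erase 0) (fun h => hx (Finset.mem_erase.1 h).2), zero_mul]

/-- **`G_A(0,0) · P⁰(ξ_A < τ₀⁺) = 1`**: the number of visits to the origin before leaving `A` is
geometric with parameter the escape probability; here from the first-step equation at `0` and
`killedGreen_eq_hitProb_mul`: `G(0,0) = 1 + ¼ Σ_{w ∼ 0} H_{A∖{0}}(w,0) G(0,0)`.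
[cite: Lawler1991, §1.5] -/
theorem killedGreen_origin_mul_escape (h0 : (0 : Site 2) ∈ A) :
    SRW.killedGreen (ChordalLERW.siteGraph (↑A : Set (Site 2))) 0 0 *
      (1 - (4 : ℝ)⁻¹ * ∑ w ∈ (zdGraph 2).neighborFinset 0, poissonKernel (A.erase 0) w 0) = 1 := by
  classical
  have hfs := killedGreen_siteGraph_first_step A h0 0
  rw [if_pos rfl] at hfs
  have hsum : ∑ w ∈ (zdGraph 2).neighborFinset 0,
      (if w ∈ A then SRW.killedGreen (ChordalLERW.siteGraph (↑A : Set (Site 2))) w 0 else 0) =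
      ∑ w ∈ (zdGraph 2).neighborFinset 0,
        poissonKernel (A.erase 0) w 0 * SRW.killedGreen (ChordalLERW.siteGraph (↑A : Set (Site 2))) 0 0 := by
    refine Finset.sum_congr rfl fun w hw => ?_
    have hw0 : w ≠ 0 := by
      intro h
      rw [h, SimpleGraph.mem_neighborFinset] at hw
      exact (zdGraph 2).irrefl hw
    split_ifs with hwA
    · exact killedGreen_eq_hitProb_mul A h0 hw0
    · rw [poissonKernel_of_not_mem_left (A.erase 0) (fun h => hwA (Finset.mem_erase.1 h).2), zero_mul]
  rw [hsum, ← Finset.sum_mul] at hfs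
  linear_combination hfs

/-- The return probability `ρ_A = ¼ Σ_{w ∼ 0} H_{A∖{0}}(w,0)` lies in `[0, 1)` and
`G_A(0,0) = (1 - ρ_A)⁻¹`. [folklore] -/
theorem escape_pos (h0 : (0 : Site 2) ∈ A) :
    0 < 1 - (4 : ℝ)⁻¹ * ∑ w ∈ (zdGraph 2).neighborFinset 0, poissonKernel (A.erase 0) w 0 := by
  have h := killedGreen_origin_mul_escape A h0
  have hG : 0 < SRW.killedGreen (ChordalLERW.siteGraph (↑A : Set (Site 2))) 0 0 :=
    lt_of_lt_of_le one_pos (SRW.one_le_killedGreen_self (finite_support_siteGraph A) 0)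
  by_contra hle
  push Not at hle
  nlinarith [mul_nonpos_of_nonneg_of_nonpos hG.le hle]

/-- **`P⁰(ξ_A < τ₀⁺) = 1/((2/π) log dist(0,∂A) + k₀ + O(1/dist))`, two-sided** (the first display
of the proof of Lawler 1991, Thm. 2.5.2, for general sets): there is `C` such that for every finite
`A ∋ 0` whose exit points all satisfy `r ≤ |z| ≤ R` (`r ≥ 1`), the escape probability
`q_A = 1 - ¼ Σ_{w ∼ 0} H_{A∖{0}}(w,0)` satisfies
`q_A ((2/π) log r + k₀ - C/r) ≤ 1 ≤ q_A ((2/π) log R + k₀ + C/r)`. [cite: Lawler1991, §2.5 (proof of Thm. 2.5.2)] -/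
theorem escape_log_bounds : ∃ C : ℝ, ∀ A : Finset (Site 2), (0 : Site 2) ∈ A →
    ∀ r R : ℝ, 1 ≤ r →
      (∀ z ∈ outerBoundary (zdGraph 2) A, r ≤ ‖Site.toComplex z‖ ∧ ‖Site.toComplex z‖ ≤ R) →
      (1 - (4 : ℝ)⁻¹ * ∑ w ∈ (zdGraph 2).neighborFinset 0, poissonKernel (A.erase 0) w 0) *
            (2 / Real.pi * Real.log r + greenConst - C / r) ≤ 1 ∧
        1 ≤ (1 - (4 : ℝ)⁻¹ * ∑ w ∈ (zdGraph 2).neighborFinset 0, poissonKernel (A.erase 0) w 0) *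
            (2 / Real.pi * Real.log R + greenConst + C / r) := by
  obtain ⟨C, hC⟩ := killedGreen_origin_log_bounds
  refine ⟨C, fun A h0 r R hr hann => ?_⟩
  obtain ⟨hlow, hupp⟩ := hC A h0 r R hr hann
  have hq := killedGreen_origin_mul_escape A h0
  have hq0 := escape_pos A h0
  set q := 1 - (4 : ℝ)⁻¹ * ∑ w ∈ (zdGraph 2).neighborFinset 0, poissonKernel (A.erase 0) w 0 with hqdef
  constructor
  · calc q * (2 / Real.pi * Real.log r + greenConst - C / r)
        ≤ q * SRW.killedGreen (ChordalLERW.siteGraph (↑A : Set (Site 2))) 0 0 :=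
          mul_le_mul_of_nonneg_left hlow hq0.le
      _ = 1 := by rw [mul_comm, hq]
  · calc (1 : ℝ) = q * SRW.killedGreen (ChordalLERW.siteGraph (↑A : Set (Site 2))) 0 0 := by
          rw [mul_comm, hq]
      _ ≤ q * (2 / Real.pi * Real.log R + greenConst + C / r) :=
          mul_le_mul_of_nonneg_left hupp hq0.le

end PlanarSet

end KozdronLawler

end Literature.Probability.LatticeModels

end
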